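import Literature.Probability.Percolation.ZdOneArmGluing
import Literature.Probability.Percolation.ZdNearCriticalWindowProofs
import HarnessLib

/-!
# One-arm extendability and quasi-multiplicativity below `L_ε(p)`, bond percolation on `ℤ²`

Topic `Literature/Probability/Percolation`; proofs only (no definition, no named fact). A
bottom-up layer towards the named fact `Kesten1987_zdKestenRelation`
(`ZdNearCriticalWindow.lean`): the quantified, near-critical form of the one-arm (`j = 1`) case
of Nolin 2008, Prop. 12 (extendability) and Prop. 13 (quasi-multiplicativity) [arXiv 0711.4948:
Props. 11–12] — "the estimates for crossing probabilities [(3.8)] … imply that when `n` is not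
larger than `L(p)`, things can still be compared to critical percolation" (§3.2) — for bond
percolation on `ℤ²` and the one-arm event `sqAnnulusOpenCrossing m n` (`𝒜₁(A_{m,n})`). The
gluing itself is `ZdOneArmGluing.lean` (every `p`, circuit probability symbolic); here the
circuit and rectangle factors are evaluated by the RSW bounds below the characteristic length
(`Nolin2008_zdRSW_below_charLength`, `Nolin2008_zdCircuit_below_charLength`,
`ZdNearCriticalWindowProofs.lean`) on the sub-critical side `p < 1/2`, and by the critical
constants on the super-critical side `p ≥ 1/2` (`rsw_lowerBound_of_half_le`,
`exists_le_real_openCircuitAround_of_half_le`):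

* `real_sqAnnulusOpenCrossing_ge_inner` — lowering the inner radius:
  `P_p(𝒜₁(A_{m,n})) ≥ crossingProb p (3l - m) (2m) · P_p(O(l)) · P_p(𝒜₁(A_{l+1,n}))`;
* `Nolin2008_zdOneArm_quasiMult_of_lt_half`, `…_of_half_le` — **quasi-multiplicativity**:
  `P_p(𝒜₁(A_{m,n})) ≥ c · P_p(𝒜₁(A_{m,3l})) · P_p(𝒜₁(A_{l+1,n}))` with `c = (ε⁶/4)^{48}`
  for `p < 1/2`, `2l ≤ L_ε(p)`, and an absolute `c` for `p ≥ 1/2`;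
* `Nolin2008_zdOneArm_extend_of_lt_half`, `…_of_half_le` — **extendability (outwards by the
  factor `4(l+1)/3l`)**: `P_p(𝒜₁(A_{m,4(l+1)})) ≥ c · P_p(𝒜₁(A_{m,3l}))` with
  `c = (ε⁶/4)^{48} · (ε⁶/4)^6` for `p < 1/2`, `2l + 3 ≤ L_ε(p)`, and an absolute `c` for
  `p ≥ 1/2`.
-/

noncomputable section

open MeasureTheory Set
open scoped unitInterval

namespace Literature.Probability.Percolation

open LatticeModels

/-- **Lowering the inner radius of a one-arm event** (Nolin 2008, Prop. 12 (ii) for `j = 1`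
[arXiv: Prop. 11]; every `p`): for `1 ≤ m ≤ l+1 ≤ 3l ≤ n`,
`crossingProb p (3l - m) (2m) · P_p(O(l)) · P_p(𝒜₁(A_{l+1,n})) ≤ P_p(𝒜₁(A_{m,n}))` — a long-way
crossing of `[m, 3l] × [-m, m]` crosses `A_{m,3l}` and is glued to the given arm through a
circuit of `A(l)` (`real_sqAnnulusOpenCrossing_ge_glue`). [cite: Nolin2008, §4.3, Prop. 12 (ii) (arXiv 0711.4948: Prop. 11)] -/
theorem real_sqAnnulusOpenCrossing_ge_inner (p : unitInterval) {m l n : ℕ} (hm : 1 ≤ m)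
    (hml : m ≤ l + 1) (hm3 : m ≤ 3 * l) (hln : 3 * l ≤ n) :
    crossingProb p (3 * l - m) (2 * m) * (bondPercolation (zdGraph 2) p).real (openCircuitAround l) *
        (bondPercolation (zdGraph 2) p).real (sqAnnulusOpenCrossing (l + 1) n) ≤
      (bondPercolation (zdGraph 2) p).real (sqAnnulusOpenCrossing m n) := by
  have h1 := real_sqAnnulusOpenCrossing_ge_glue p hm hml hln
  have h2 := crossingProb_le_real_sqAnnulusOpenCrossing p hm hm3
  refine le_trans ?_ h1
  exact mul_le_mul_of_nonneg_right (mul_le_mul_of_nonneg_right h2 measureReal_nonneg)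
    measureReal_nonneg

/-! ### Quasi-multiplicativity with explicit constants -/

/-- **One-arm quasi-multiplicativity below `L_ε(p)`, sub-critical side** (Nolin 2008, Prop. 13
for `j = 1` [arXiv: Prop. 12], uniformly in `p` for the scales below the characteristic length;
Kesten 1987, §2): for `ε ∈ (0,1/2)`, `p < 1/2`, `1 ≤ m ≤ l+1`, `1 ≤ l`, `3l ≤ n` and
`2l ≤ L_ε(p)`, `(ε⁶/4)^{48} · P_p(𝒜₁(A_{m,3l})) · P_p(𝒜₁(A_{l+1,n})) ≤ P_p(𝒜₁(A_{m,n}))`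
(the circuit of `A(l)` costs `(ε⁶/4)^{48}`, `Nolin2008_zdCircuit_below_charLength`).
[cite: Nolin2008, §4.3, Prop. 13 (arXiv 0711.4948: Prop. 12)] [cite: KestenScalingCMP1987, §2] -/
theorem Nolin2008_zdOneArm_quasiMult_of_lt_half {ε : ℝ} (hε : 0 < ε) (hε' : ε < 1 / 2)
    {p : unitInterval} (hp : (p : ℝ) < 1 / 2) {m l n : ℕ} (hm : 1 ≤ m) (hml : m ≤ l + 1)
    (hl : 1 ≤ l) (hln : 3 * l ≤ n) (hlL : 2 * l ≤ zdCharLength ε p) :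
    ((ε ^ 6 / 4) ^ (3 * 4)) ^ 4 * (bondPercolation (zdGraph 2) p).real (sqAnnulusOpenCrossing m (3 * l)) *
        (bondPercolation (zdGraph 2) p).real (sqAnnulusOpenCrossing (l + 1) n) ≤
      (bondPercolation (zdGraph 2) p).real (sqAnnulusOpenCrossing m n) := by
  have h1 := real_sqAnnulusOpenCrossing_ge_glue p hm hml hln
  have h2 := Nolin2008_zdCircuit_below_charLength hε hε' hp hl hlL
  refine le_trans ?_ h1
  rw [mul_comm (((ε ^ 6 / 4) ^ (3 * 4)) ^ 4)]
  exact mul_le_mul_of_nonneg_right (mul_le_mul_of_nonneg_left h2 measureReal_nonneg)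
    measureReal_nonneg

/-- **One-arm quasi-multiplicativity, super-critical side at every scale**: there is an absolute
`c > 0` with `c · P_p(𝒜₁(A_{m,3l})) · P_p(𝒜₁(A_{l+1,n})) ≤ P_p(𝒜₁(A_{m,n}))` for all `p ≥ 1/2`,
`1 ≤ m ≤ l+1`, `1 ≤ l`, `3l ≤ n` (`exists_le_real_openCircuitAround_of_half_le`).
[cite: Nolin2008, §4.3, Prop. 13 (arXiv 0711.4948: Prop. 12)] -/
theorem Nolin2008_zdOneArm_quasiMult_of_half_le :
    ∃ c : ℝ, 0 < c ∧ ∀ p : unitInterval, 1 / 2 ≤ (p : ℝ) → ∀ m l n : ℕ, 1 ≤ m → m ≤ l + 1 →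
      1 ≤ l → 3 * l ≤ n →
        c * (bondPercolation (zdGraph 2) p).real (sqAnnulusOpenCrossing m (3 * l)) *
            (bondPercolation (zdGraph 2) p).real (sqAnnulusOpenCrossing (l + 1) n) ≤
          (bondPercolation (zdGraph 2) p).real (sqAnnulusOpenCrossing m n) := by
  obtain ⟨c, hc, h⟩ := exists_le_real_openCircuitAround_of_half_le
  refine ⟨c, hc, fun p hp m l n hm hml hl hln => ?_⟩
  have h1 := real_sqAnnulusOpenCrossing_ge_glue p hm hml hln
  have h2 := h p hp l hl
  refine le_trans ?_ h1
  rw [mul_comm c]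
  exact mul_le_mul_of_nonneg_right (mul_le_mul_of_nonneg_left h2 measureReal_nonneg)
    measureReal_nonneg

/-! ### Extendability with explicit constants -/

/-- The `3(l+1) × 2(l+1)` rectangle factor below `L_ε(p)`: for `p < 1/2` and `2l + 3 ≤ L_ε(p)`,
`crossingProb p (3(l+1)) (2(l+1)) ≥ (ε⁶/4)^6` (`Nolin2008_zdRSW_below_charLength` with `k = 2`
at height `2l + 3`, and antitonicity in the width). [cite: Nolin2008, §3.2 (3.8)] -/
theorem crossingProb_three_two_ge_of_lt_half {ε : ℝ} (hε : 0 < ε) (hε' : ε < 1 / 2)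
    {p : unitInterval} (hp : (p : ℝ) < 1 / 2) {l : ℕ} (hlL : 2 * l + 3 ≤ zdCharLength ε p) :
    (ε ^ 6 / 4) ^ (3 * 2) ≤ crossingProb p (3 * (l + 1)) (2 * (l + 1)) := by
  have h := Nolin2008_zdRSW_below_charLength hε hε' (k := 2) le_rfl hp (n := 2 * l + 3)
    (by omega) hlL
  rw [show 2 * l + 3 - 1 = 2 * (l + 1) by omega] at h
  exact h.trans (crossingProb_anti_left p (by omega) _)

/-- **One-arm extendability below `L_ε(p)`, sub-critical side** (Nolin 2008, Prop. 12 (i) for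
`j = 1` [arXiv: Prop. 11]; Kesten 1987, §2): for `ε ∈ (0,1/2)`, `p < 1/2`, `1 ≤ m ≤ l+1`,
`1 ≤ l` and `2l + 3 ≤ L_ε(p)`,
`(ε⁶/4)^{48} · (ε⁶/4)^6 · P_p(𝒜₁(A_{m,3l})) ≤ P_p(𝒜₁(A_{m,4(l+1)}))`.
[cite: Nolin2008, §4.3, Prop. 12 (i) (arXiv 0711.4948: Prop. 11)] [cite: KestenScalingCMP1987, §2] -/
theorem Nolin2008_zdOneArm_extend_of_lt_half {ε : ℝ} (hε : 0 < ε) (hε' : ε < 1 / 2)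
    {p : unitInterval} (hp : (p : ℝ) < 1 / 2) {m l : ℕ} (hm : 1 ≤ m) (hml : m ≤ l + 1)
    (hl : 1 ≤ l) (hlL : 2 * l + 3 ≤ zdCharLength ε p) :
    ((ε ^ 6 / 4) ^ (3 * 4)) ^ 4 * (ε ^ 6 / 4) ^ (3 * 2) *
        (bondPercolation (zdGraph 2) p).real (sqAnnulusOpenCrossing m (3 * l)) ≤
      (bondPercolation (zdGraph 2) p).real (sqAnnulusOpenCrossing m (4 * (l + 1))) := by
  have h1 := real_sqAnnulusOpenCrossing_extend p hm hml (l := l)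
  have h2 := Nolin2008_zdCircuit_below_charLength hε hε' hp hl (by omega)
  have h3 := crossingProb_three_two_ge_of_lt_half hε hε' hp hlL
  refine le_trans ?_ h1
  have h0 : 0 ≤ (bondPercolation (zdGraph 2) p).real (sqAnnulusOpenCrossing m (3 * l)) :=
    measureReal_nonneg
  calc ((ε ^ 6 / 4) ^ (3 * 4)) ^ 4 * (ε ^ 6 / 4) ^ (3 * 2) *
        (bondPercolation (zdGraph 2) p).real (sqAnnulusOpenCrossing m (3 * l))
      = (bondPercolation (zdGraph 2) p).real (sqAnnulusOpenCrossing m (3 * l)) *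
          ((ε ^ 6 / 4) ^ (3 * 4)) ^ 4 * (ε ^ 6 / 4) ^ (3 * 2) := by ring
    _ ≤ (bondPercolation (zdGraph 2) p).real (sqAnnulusOpenCrossing m (3 * l)) *
          (bondPercolation (zdGraph 2) p).real (openCircuitAround l) *
          crossingProb p (3 * (l + 1)) (2 * (l + 1)) :=
        mul_le_mul (mul_le_mul_of_nonneg_left h2 h0) h3 (by positivity)
          (mul_nonneg h0 measureReal_nonneg)

/-- **One-arm extendability, super-critical side at every scale**: there is an absolute `c > 0`
with `c · P_p(𝒜₁(A_{m,3l})) ≤ P_p(𝒜₁(A_{m,4(l+1)}))` for all `p ≥ 1/2`, `1 ≤ m ≤ l+1`, `1 ≤ l`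
(`exists_le_real_openCircuitAround_of_half_le`, `rsw_lowerBound_of_half_le` with `k = 2`).
[cite: Nolin2008, §4.3, Prop. 12 (i) (arXiv 0711.4948: Prop. 11)] -/
theorem Nolin2008_zdOneArm_extend_of_half_le :
    ∃ c : ℝ, 0 < c ∧ ∀ p : unitInterval, 1 / 2 ≤ (p : ℝ) → ∀ m l : ℕ, 1 ≤ m → m ≤ l + 1 → 1 ≤ l →
      c * (bondPercolation (zdGraph 2) p).real (sqAnnulusOpenCrossing m (3 * l)) ≤
        (bondPercolation (zdGraph 2) p).real (sqAnnulusOpenCrossing m (4 * (l + 1))) := by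
  obtain ⟨c₁, hc₁, h₁⟩ := exists_le_real_openCircuitAround_of_half_le
  obtain ⟨c₂, hc₂, h₂⟩ := rsw_lowerBound_of_half_le (k := 2) le_rfl
  refine ⟨c₁ * c₂, mul_pos hc₁ hc₂, fun p hp m l hm hml hl => ?_⟩
  have g1 := real_sqAnnulusOpenCrossing_extend p hm hml (l := l)
  have g2 := h₁ p hp l hl
  have g3 : c₂ ≤ crossingProb p (3 * (l + 1)) (2 * (l + 1)) := by
    have h := h₂ p hp (2 * l + 3) (by omega)
    rw [show 2 * l + 3 - 1 = 2 * (l + 1) by omega] at h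
    exact h.trans (crossingProb_anti_left p (by omega) _)
  refine le_trans ?_ g1
  have h0 : 0 ≤ (bondPercolation (zdGraph 2) p).real (sqAnnulusOpenCrossing m (3 * l)) :=
    measureReal_nonneg
  calc c₁ * c₂ * (bondPercolation (zdGraph 2) p).real (sqAnnulusOpenCrossing m (3 * l))
      = (bondPercolation (zdGraph 2) p).real (sqAnnulusOpenCrossing m (3 * l)) * c₁ * c₂ := by ring
    _ ≤ (bondPercolation (zdGraph 2) p).real (sqAnnulusOpenCrossing m (3 * l)) *
          (bondPercolation (zdGraph 2) p).real (openCircuitAround l) *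
          crossingProb p (3 * (l + 1)) (2 * (l + 1)) :=
        mul_le_mul (mul_le_mul_of_nonneg_left g2 h0) g3 hc₂.le (mul_nonneg h0 measureReal_nonneg)

end Literature.Probability.Percolation
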